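import Summits.Ventures.HodgeRepro2.IsotypicProjector

/-!
# T4Separating — a separating element exists for the Galois twists (Tier 4, T4-A)

Seat p3 of the blind cell `pub-hodge-repro2` (Tier 4, README §6).  Imports `IsotypicProjector`.

`IsotypicProjector.lean` builds the `𝐅`-diagonal projector from a SEPARATING element `θ`:
`s_i θ ≠ θ` for every twist `s_i ≠ id`.  For the twists of the transfer — the elements of
`Gal(𝐅/ℚ)` — such a `θ` is a primitive element of `𝐅/ℚ` (an automorphism fixing a primitive
element fixes the field it generates, i.e. everything), whose existence is the primitive element
theorem (Mathlib `Field.exists_primitive_element`; TIER4.md Lemma A2.1 «choose `a ∈ O_F` with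
`F = ℚ(a)`»).  This file records the discharge: `exists_separating` (for any finite
extension of `ℚ`) and `exists_separating_gal` (the form the isotypic projector needs, with the
twists indexed by `Gal(𝐅/ℚ)` itself and `i₀ = 1`), together with the instantiated projector
statements `galIsotypicProjector_*` on any `TwoActions 𝐅 V`.

Axioms: propext, Classical.choice, Quot.sound.
-/

namespace Summit.Ventures.HodgeRepro2.T4Separating

open Summit.Ventures.HodgeRepro2.IsotypicProjector

variable (F : Type*) [Field F] [Algebra ℚ F] [FiniteDimensional ℚ F]

/-- PRIMITIVE ELEMENTS SEPARATE: there is `θ ∈ F` moved by every non-trivial ℚ-automorphism. -/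
theorem exists_separating : ∃ θ : F, ∀ σ : F ≃ₐ[ℚ] F, σ ≠ 1 → σ θ ≠ θ := by
  obtain ⟨α, hα⟩ := Field.exists_primitive_element ℚ F
  refine ⟨α, fun σ hσ hfix => hσ ?_⟩
  have hinv : σ⁻¹ α = α := by
    rw [AlgEquiv.aut_inv]
    exact (congrArg σ.symm hfix).symm.trans (σ.symm_apply_apply α)
  have hpow : ∀ k : ℤ, (σ ^ k) α = α := by
    intro k
    induction k using Int.induction_on with
    | zero => simp
    | succ n ih => rw [zpow_add_one, AlgEquiv.mul_apply, hfix, ih]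
    | pred n ih => rw [zpow_sub_one, AlgEquiv.mul_apply, hinv, ih]
  have hmem : α ∈ IntermediateField.fixedField (Subgroup.zpowers σ) := by
    rw [IntermediateField.mem_fixedField_iff]
    intro f hf
    obtain ⟨k, rfl⟩ := Subgroup.mem_zpowers_iff.mp hf
    exact hpow k
  have htop : (⊤ : IntermediateField ℚ F) ≤ IntermediateField.fixedField (Subgroup.zpowers σ) := by
    rw [← hα]
    exact IntermediateField.adjoin_simple_le_iff.mpr hmem
  ext x
  have hx : x ∈ IntermediateField.fixedField (Subgroup.zpowers σ) := htop trivial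
  rw [IntermediateField.mem_fixedField_iff] at hx
  exact hx σ (Subgroup.mem_zpowers σ)

/-- The twists of the transfer: the Galois group, as ℚ-algebra endomorphisms of `F`. -/
def galTwist (σ : F ≃ₐ[ℚ] F) : F →ₐ[ℚ] F := σ.toAlgHom

omit [FiniteDimensional ℚ F] in
/-- The trivial twist is the identity. -/
theorem galTwist_one : galTwist F (1 : F ≃ₐ[ℚ] F) = AlgHom.id ℚ F := by
  ext x
  rfl

/-- A separating element for the Galois twists with `i₀ = 1`, in the form `IsotypicProjector`
needs. -/
theorem exists_separating_gal :
    ∃ θ : F, ∀ σ : F ≃ₐ[ℚ] F, σ ≠ 1 → galTwist F σ θ ≠ θ :=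
  exists_separating F

variable {F} [Fintype (F ≃ₐ[ℚ] F)] [DecidableEq (F ≃ₐ[ℚ] F)]
variable {V : Type*} [AddCommGroup V] [Module ℚ V]

omit [FiniteDimensional ℚ F] in
/-- THE GALOIS ISOTYPIC PROJECTOR: for two commuting `F`-actions and a separating `θ`, the
projector `e = ρ₁(c⁻¹)·Q(ρ₂θ)` of `IsotypicProjector` with the twists `Gal(F/ℚ)` is the identity on
the diagonal component. -/
theorem galIsotypicProjector_apply_of_mem_diagonal (A : TwoActions F V) {θ : F}
    (hsep : ∀ σ : F ≃ₐ[ℚ] F, σ ≠ 1 → galTwist F σ θ ≠ θ) {v : V}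
    (hv : v ∈ A.component (AlgHom.id ℚ F)) :
    isotypicProjector A (galTwist F) 1 θ v = v := by
  apply isotypicProjector_apply_of_mem_component_self A (galTwist F) 1 θ (galTwist_one F) hsep
  rw [galTwist_one]
  exact hv

omit [FiniteDimensional ℚ F] in
/-- … and zero on the `σ`-components, `σ ≠ 1`. -/
theorem galIsotypicProjector_apply_of_mem_twist (A : TwoActions F V) (θ : F)
    {σ : F ≃ₐ[ℚ] F} (hσ : σ ≠ 1) {v : V} (hv : v ∈ A.component (galTwist F σ)) :
    isotypicProjector A (galTwist F) 1 θ v = 0 :=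
  isotypicProjector_apply_of_mem_component_ne A (galTwist F) 1 θ hσ hv

omit [FiniteDimensional ℚ F] in
/-- … and it lies in the algebra generated by the two actions. -/
theorem galIsotypicProjector_mem_adjoin (A : TwoActions F V) (θ : F) :
    isotypicProjector A (galTwist F) 1 θ ∈
      Algebra.adjoin ℚ (Set.range A.ρ₁ ∪ Set.range A.ρ₂ : Set (Module.End ℚ V)) :=
  isotypicProjector_mem_adjoin A (galTwist F) 1 θ

/-- EXISTENCE of the Galois isotypic projector with all three properties, for every pair of
commuting `F`-actions (the separating element supplied by the primitive element theorem). -/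
theorem exists_galIsotypicProjector (A : TwoActions F V) :
    ∃ e : Module.End ℚ V,
      (∀ v ∈ A.component (AlgHom.id ℚ F), e v = v) ∧
      (∀ σ : F ≃ₐ[ℚ] F, σ ≠ 1 → ∀ v ∈ A.component (galTwist F σ), e v = 0) ∧
      e ∈ Algebra.adjoin ℚ (Set.range A.ρ₁ ∪ Set.range A.ρ₂ : Set (Module.End ℚ V)) := by
  obtain ⟨θ, hθ⟩ := exists_separating_gal F
  exact ⟨isotypicProjector A (galTwist F) 1 θ,
    fun v hv => galIsotypicProjector_apply_of_mem_diagonal A hθ hv,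
    fun σ hσ v hv => galIsotypicProjector_apply_of_mem_twist A θ hσ hv,
    galIsotypicProjector_mem_adjoin A θ⟩

end Summit.Ventures.HodgeRepro2.T4Separating
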